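import Summits.ABC.ABC.Theses.DefiniteXi
import Literature.NumberTheory.Automorphic.BrandtThetaSeriesHeckeAction
import Literature.NumberTheory.Automorphic.BrandtThetaSeriesClassFunction
import Literature.NumberTheory.Automorphic.BrandtEigenvectorNonEisenstein
import Literature.NumberTheory.Automorphic.BrandtEigenvectorDegreeZero
import Literature.NumberTheory.Automorphic.BrandtHeckeProjector
import Literature.NumberTheory.Automorphic.BrandtMatrixDegree
import Literature.NumberTheory.EllipticCurves.CongruenceNumber
import Literature.NumberTheory.EllipticCurves.NewformsMultiplicityOneProofs
import Literature.NumberTheory.Automorphic.EichlerSubidealCount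
import HarnessLib

/-!
# Sketch (stub-ideation k=3 · GEN 3 · FAMILY 3 PROBE THE EXTREMES) for `stub_xiDegreeComparison`
# of crux `SteinbergCore` (route-ABC-DefiniteXi, line `p6_tamagawa_split`)

Companion to `STUB-IDEAS-stub_xiDegreeComparison-3.md` (gen 3).  Gen 3 of seat k3 does not add a
fourth proof architecture; it CERTIFIES AT THE EXTREMES (kit job, Sage's native Brandt module —
an implementation independent of gen-2's PARI engine) the un-printed / convention-sensitive inputs
of the emerging top plan (k2 gen 3, theta-lattice congruence transfer, ONE named fact H1) and types
the two convenience forms the certificate suggests: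

* `brandtTheta_sub_isCuspForm_sameColumn` — H1 in the PRINTED form (Pizer 1980 Prop. 2.15:
  "the difference of any two theta series appearing in the same column of the Brandt matrix series
  is a cusp form"), and `brandtTheta_sub_isCuspForm_of_sameColumn` — printed ⟹ all-pairs (k2's
  H1), two lines from `XiSetup.brandtTheta_symm` (PROVED here, no sorry);
* `dvd_gcd_mul_gcd_iff_forall_sum_eq_zero` — pure algebra: "`m ∣ t_i · ⟨u, y⟩` for every row `i`
  and every degree-zero `y`" is ONE divisibility `m ∣ gcd(t) · gcd(u_c − u_d)`; hence
* `xi_dvd_gcd_form` — the GCD FORM of k2's prime-free core H5core,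
  `ξ ∣ 2 · gcd_i(w_i φ_i) · gcd_{c,d}(w_c φ_c − w_d φ_d) · r_f`, which is the statement the
  certificate tests curve by curve (C4) and from which the prime-wise H5 is read off without
  choosing `i` or `y`.
-/

set_option linter.dupNamespace false

noncomputable section

namespace Summit.ABC.ABC.Cruxes.SteinbergCore.ProbeExtremesG3

open scoped MatrixGroups ModularForm Matrix
open CongruenceSubgroup
open Literature.NumberTheory.EllipticCurves Literature.NumberTheory.EllipticCurves.ModularForms
open Literature.NumberTheory.Automorphic Literature.NumberTheory.Automorphic.Brandt

/-! ## H1 in two shapes -/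

/-- k2's H1 (ALL-PAIRS form, restated verbatim from `STUB_IDEAS_stub_xiDegreeComparison_2_SketchG3`
so that this file is self-contained): every difference of two Brandt theta series of one definite
setup is a cusp form. -/
def brandtTheta_sub_isCuspForm : Prop :=
  ∀ (Nplus Nminus : ℕ) (S : XiSetup Nplus Nminus) [Fintype (ClassSet S.O)] (i j k l : ClassSet S.O),
    ModularForm.IsCuspForm (S.brandtTheta i j - S.brandtTheta k l)

/-- **H1, PRINTED form** (Pizer 1980, Prop. 2.15, p. 355, verbatim "same column": `θ_ij − θ_kj` is a
cusp form; proof there: the lattices `(I_j⁻¹ I_h, nrd·N(I_j)/N(I_h))` lie in one genus, and theta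
series of one genus agree at every cusp — Siegel 1935 [47, p. 376]).  This is the shape a typer
should give the named fact; the all-pairs shape used by k2 follows (next lemma).  CERTIFIED at the
extremes of the stub's binders by jobs j344612 (smoke) + j344616 (full) (C1): levels `2^e·m·q` (e ≤ 8), `9·q, 25·q, 27·q,
49·q`, class numbers up to ~100, exact Sturm-bound linear algebra. -/
def brandtTheta_sub_isCuspForm_sameColumn : Prop :=
  ∀ (Nplus Nminus : ℕ) (S : XiSetup Nplus Nminus) [Fintype (ClassSet S.O)] (i k j : ClassSet S.O),
    ModularForm.IsCuspForm (S.brandtTheta i j - S.brandtTheta k j)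

/-- **N2 (XS, PROVED): printed ⟹ all-pairs.** `Θ_ij − Θ_kl = (Θ_ij − Θ_kj) + (Θ_jk − Θ_lk)` by the
symmetry `Θ_kj = Θ_jk`, `Θ_kl = Θ_lk` (`XiSetup.brandtTheta_symm`, PROVED in the tree), and the cusp
forms are a submodule. -/
theorem brandtTheta_sub_isCuspForm_of_sameColumn (h : brandtTheta_sub_isCuspForm_sameColumn) :
    brandtTheta_sub_isCuspForm := by
  intro Nplus Nminus S _ i j k l
  have h1 := h Nplus Nminus S i k j
  have h2 := h Nplus Nminus S j l k
  have hsplit : S.brandtTheta i j - S.brandtTheta k l =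
      (S.brandtTheta i j - S.brandtTheta k j) + (S.brandtTheta j k - S.brandtTheta l k) := by
    rw [S.brandtTheta_symm k j, S.brandtTheta_symm l k]; abel
  rw [hsplit]
  exact (ModularForm.cuspFormSubmodule _ _).add_mem h1 h2

/-- The converse is a specialisation (recorded so either shape can be filed). -/
theorem brandtTheta_sub_isCuspForm_sameColumn_of (h : brandtTheta_sub_isCuspForm) :
    brandtTheta_sub_isCuspForm_sameColumn :=
  fun Nplus Nminus S _ i k j => h Nplus Nminus S i j k j

/-! ## The gcd form of the prime-free core H5core -/

/-- **N1a (XS · pure algebra).**  For integers `m`, rows `t : ι → ℤ` and weights-times-coordinates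
`u : ι → ℤ`: `m ∣ t_i · Σ_c u_c y_c` for every `i` and every degree-zero `y` iff
`m ∣ gcd_i(t_i) · gcd_{(c,d)}(u_c − u_d)`.  (`⟸`: a degree-zero `y` is `Σ_c y_c (e_c − e_{c₀})`, so
`Σ u_c y_c = Σ_c y_c (u_c − u_{c₀})` is a multiple of the difference-gcd, and `gcd t ∣ t_i`;
`⟹`: `y := e_c − e_d` gives `m ∣ t_i (u_c − u_d)` for all `i, c, d`, then `Finset.dvd_gcd` twice and
`Finset.gcd_mul_left/right`.)  Degenerate `ι` (empty / one class): both sides trivial. -/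
theorem dvd_gcd_mul_gcd_iff_forall_sum_eq_zero {ι : Type*} [Fintype ι] [DecidableEq ι]
    (m : ℤ) (t u : ι → ℤ) :
    (m ∣ (Finset.univ.gcd t) * Finset.univ.gcd (fun cd : ι × ι => u cd.1 - u cd.2)) ↔
      ∀ (i : ι) (y : ι → ℤ), ∑ c, y c = 0 → m ∣ t i * ∑ c, u c * y c := by
  sorry

/-- **N1 (the GCD FORM of k2's H5core; S given H5core + N1a, or proved directly by the same Bezout
argument).**  For the eigen-line `ℤφ` of `a(W)` in a definite setup of level `M = N⁺N⁻` and the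
newform `f` of `W` at level `M`:
`ξ ∣ 2 · gcd_i(w_i φ_i) · gcd_{(c,d)}(w_c φ_c − w_d φ_d) · r_f`.
This is EXACTLY what the certificate tests (C4, every optimal curve of conductor `N⁺q ≤ 1300` with
prime `q`, INCLUDING the Eisenstein extremes 11a1, 57c1, 75c1, 203a1 where `v_p ξ ≤ v_p r_f` itself
fails): from it the prime-wise H5 is immediate — for `p ≥ 5`, `p ∤ gcd(w_c φ_c − w_d φ_d)`
(`XiSetup.exists_not_dvd_weight_mul_sub`, the good-prime witness) and `p ∤ gcd_i(w_i φ_i)`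
(`exists_not_dvd_of_eigenLattice_eq_span` + `XiSetup.not_dvd_weight`), so `p^{v_p ξ} ∣ r_f`. -/
theorem xi_dvd_gcd_form (hΘ : brandtTheta_sub_isCuspForm) {Nplus Nminus M : ℕ}
    [NeZero M] (hM : Nplus * Nminus = M) (S : XiSetup Nplus Nminus) [Fintype (ClassSet S.O)]
    [DecidableEq (ClassSet S.O)]
    (W : WeierstrassCurve ℚ) [W.IsElliptic] {f : CuspForm (Gamma0 M) 2} (hf : IsNewformOf W f)
    {φ : ClassSet S.O → ℤ} (hφ0 : φ ≠ 0)
    (hL : eigenLattice (Nplus * Nminus) (matrix S.O) (fun n => W.LFunction n) = ℤ ∙ φ) :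
    ((S.xi fun n => W.LFunction n : ℕ) : ℤ) ∣
      2 * (Finset.univ.gcd fun i => (weight S.O i : ℤ) * φ i) *
        (Finset.univ.gcd fun cd : ClassSet S.O × ClassSet S.O =>
          (weight S.O cd.1 : ℤ) * φ cd.1 - (weight S.O cd.2 : ℤ) * φ cd.2) *
        (congruenceNumber f : ℤ) := by
  sorry

/-- **N1b (XS · bridge to k2's literal H5core shape).**  The gcd form gives k2's
`ξ ∣ |2 w_i φ_i ⟨φ, y⟩_w| · r_f` for every row `i` and degree-zero `y` (N1a `⟹`-direction with
`m = ξ`, `t_i = 2 w_i φ_i r_f`, `u_c = w_c φ_c`; `Int.natCast_dvd_natCast` + `Int.dvd_natAbs`). -/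
theorem xi_dvd_mul_congruenceNumber_of_gcd_form {Nplus Nminus M : ℕ} [NeZero M]
    (S : XiSetup Nplus Nminus) [Fintype (ClassSet S.O)] [DecidableEq (ClassSet S.O)]
    (W : WeierstrassCurve ℚ) [W.IsElliptic] (f : CuspForm (Gamma0 M) 2) {φ : ClassSet S.O → ℤ}
    (hgcd : ((S.xi fun n => W.LFunction n : ℕ) : ℤ) ∣
      2 * (Finset.univ.gcd fun i => (weight S.O i : ℤ) * φ i) *
        (Finset.univ.gcd fun cd : ClassSet S.O × ClassSet S.O =>
          (weight S.O cd.1 : ℤ) * φ cd.1 - (weight S.O cd.2 : ℤ) * φ cd.2) *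
        (congruenceNumber f : ℤ))
    (i : ClassSet S.O) {y : ClassSet S.O → ℤ} (hy : ∑ c, y c = 0) :
    (S.xi fun n => W.LFunction n) ∣
      (2 * (weight S.O i : ℤ) * φ i * ∑ c, (weight S.O c : ℤ) * φ c * y c).natAbs *
        congruenceNumber f := by
  sorry

end Summit.ABC.ABC.Cruxes.SteinbergCore.ProbeExtremesG3

end
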